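import Summits.Ventures.HodgeRepro2.T5SU11SphericalProduct

/-!
# The spherical functions of `SU(1,1)` are eigenfunctions of convolution by `K`-invariant functions:
`∫_G f(h) φ_λ(h⁻¹ g) dh = f̂(λ) · φ_λ(g)`, `f̂(λ) = ∫_G f φ_λ dh` (the spherical transform)

For a Haar measure `μ` on `SU(1,1)`, an integrable left-`K`-invariant `f` (`f (k h) = f h`) and
`0 ≤ λ ≤ 2` (where `0 < φ_λ ≤ 1`, `T5SU11SphericalBounds`): substituting `h ↦ k h` (left invariance of
`μ`, `f (k h) = f h`) gives `∫ f(h) φ_λ(h⁻¹ g) dh = ∫ f(h) φ_λ(h⁻¹ k⁻¹ g) dh` for every `k ∈ K`; averaging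
over `k` against `dk`, exchanging the integrals (Fubini on `K × G`, the integrand being bounded by
`|f(h)|`) and applying the product formula of `T5SU11SphericalProduct`
(`∫_K φ_λ(h⁻¹ k g) dk = φ_λ(h⁻¹) φ_λ(g)`, with `φ_λ(h⁻¹) = φ_λ(h)`) yields
**`∫_G f(h) φ_λ(h⁻¹ g) dμ(h) = (∫_G f(h) φ_λ(h) dμ(h)) · φ_λ(g)`** (`integral_mul_sph_inv_mul`):
`φ_λ` is an eigenfunction of the convolution operator `f ∗ ·` with eigenvalue the **spherical
transform** `f̂(λ) = ∫_G f φ_λ dμ` — the functional-equation form of the spherical transform on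
bi-`K`-invariant functions; the right-`K`-invariant variant `∫_G f(h) φ_λ(g h⁻¹) dμ(h) = f̂(λ) φ_λ(g)`
follows by inversion invariance (`integral_mul_sph_mul_inv`). Nothing is claimed about (N).

Blind lane: Mathlib + the HodgeRepro2 prefix only; no sorry; axioms ⊆ {propext, Classical.choice,
Quot.sound}.
-/

namespace Summit.Ventures.HodgeRepro2.T5SU11SphericalTransform

open MeasureTheory MeasureTheory.Measure Metric Set Filter Topology Complex
open T5SU11Unimodular T5SU11Fibration T5SU11Cartan T5SU11OneParameter T5SU11CartanProjection
  T5HaarCircle T5BergmanCoefficient T5SU11SphericalFunction T5SU11SphericalTwo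
  T5SU11SphericalSymmetry T5SU11SphericalBounds T5SU11SphericalContinuous
  T5SU11SphericalAsymptotic T5SU11SphericalLp T5SU11SphericalCfun T5SU11SphericalLpSharp
  T5SU11SphericalXiLog T5SU11SphericalCfunLimit T5SU11SphericalStrict T5SU11SphericalProduct
open scoped Real

section measure

variable [MeasurableSpace Circle] [BorelSpace Circle]

/-- `(u, h) ↦ sph λ (h⁻¹ · (rot u)⁻¹ · g)` is continuous on `K × G`. -/
lemma continuous_sph_inv_mul_rot_inv (lam : ℝ) (g : SU11) :
    Continuous fun p : Circle × SU11 => sph lam (p.2⁻¹ * (rot p.1)⁻¹ * g) :=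
  (continuous_sph lam).comp
    (((continuous_snd.inv).mul ((continuous_rot.comp continuous_fst).inv)).mul continuous_const)

/-- **Spherical functions are eigenfunctions of convolution by left-`K`-invariant functions**: for a
Haar measure `μ`, `f ∈ L¹(G, μ)` with `f (k h) = f h`, and `0 ≤ λ ≤ 2`,
`∫_G f(h) · sph λ (h⁻¹ g) dμ(h) = (∫_G f(h) · sph λ h dμ(h)) · sph λ g`. -/
theorem integral_mul_sph_inv_mul (μ : Measure SU11) [IsHaarMeasure μ] {lam : ℝ} (h0 : 0 ≤ lam)
    (h2 : lam ≤ 2) {f : SU11 → ℝ} (hf : Integrable f μ)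
    (hK : ∀ (u : Circle) (h : SU11), f (rot u * h) = f h) (g : SU11) :
    ∫ h, f h * sph lam (h⁻¹ * g) ∂μ = (∫ h, f h * sph lam h ∂μ) * sph lam g := by
  -- Step 1: left `K`-invariance moves a `k⁻¹` between `h⁻¹` and `g`.
  have step1 : ∀ u : Circle, ∫ h, f h * sph lam (h⁻¹ * g) ∂μ =
      ∫ h, f h * sph lam (h⁻¹ * (rot u)⁻¹ * g) ∂μ := by
    intro u
    rw [← integral_mul_left_eq_self (fun h => f h * sph lam (h⁻¹ * g)) (rot u)]
    congr 1
    funext h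
    rw [hK, mul_inv_rev, mul_assoc]
  -- Step 2: average over `K`.
  have step2 : ∫ h, f h * sph lam (h⁻¹ * g) ∂μ =
      ∫ u, ∫ h, f h * sph lam (h⁻¹ * (rot u)⁻¹ * g) ∂μ ∂haarCircle := by
    rw [← integral_congr_ae (Filter.Eventually.of_forall step1), integral_const, measureReal_def,
      haarCircle_univ, ENNReal.toReal_one, one_smul]
  -- Step 3: Fubini.
  have hint : Integrable (Function.uncurry fun (u : Circle) (h : SU11) =>
      f h * sph lam (h⁻¹ * (rot u)⁻¹ * g)) (haarCircle.prod μ) := by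
    refine (hf.comp_snd haarCircle).mul_bdd (c := 1)
      (continuous_sph_inv_mul_rot_inv lam g).aestronglyMeasurable
      (Filter.Eventually.of_forall fun p => ?_)
    rw [Real.norm_eq_abs, abs_of_pos (sph_pos lam _)]
    exact sph_le_one h0 h2 _
  rw [step2, integral_integral_swap hint]
  -- Step 4: the inner integral is the product formula.
  have step4 : ∀ h : SU11, ∫ u, f h * sph lam (h⁻¹ * (rot u)⁻¹ * g) ∂haarCircle =
      f h * sph lam h * sph lam g := by
    intro h
    rw [integral_const_mul]
    have e : (fun u : Circle => sph lam (h⁻¹ * (rot u)⁻¹ * g)) =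
        fun u : Circle => sph lam (h⁻¹ * rot u⁻¹ * g) := by
      funext u
      rw [map_inv]
    rw [e, integral_inv_eq_self (fun u : Circle => sph lam (h⁻¹ * rot u * g)) haarCircle,
      integral_sph_mul_rot_mul, sph_inv, mul_assoc]
  simp_rw [step4]
  rw [integral_mul_const]

/-- **The right-`K`-invariant variant**: for `f ∈ L¹(G, μ)` with `f (h k) = f h` and `0 ≤ λ ≤ 2`,
`∫_G f(h) · sph λ (g h⁻¹) dμ(h) = (∫_G f(h) · sph λ h dμ(h)) · sph λ g`. -/
theorem integral_mul_sph_mul_inv (μ : Measure SU11) [IsHaarMeasure μ] {lam : ℝ} (h0 : 0 ≤ lam)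
    (h2 : lam ≤ 2) {f : SU11 → ℝ} (hf : Integrable f μ)
    (hK : ∀ (h : SU11) (u : Circle), f (h * rot u) = f h) (g : SU11) :
    ∫ h, f h * sph lam (g * h⁻¹) ∂μ = (∫ h, f h * sph lam h ∂μ) * sph lam g := by
  -- pass to `f' h = f h⁻¹`, which is left-`K`-invariant and integrable
  have hf' : Integrable (fun h => f h⁻¹) μ := by
    haveI := isInvInvariant μ
    exact hf.comp_inv
  have hK' : ∀ (u : Circle) (h : SU11), (fun h => f h⁻¹) (rot u * h) = (fun h => f h⁻¹) h := by
    intro u h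
    simp only [mul_inv_rev, ← map_inv, hK]
  have h1 := integral_mul_sph_inv_mul μ h0 h2 hf' hK' g⁻¹
  have e1 : ∫ h, f h * sph lam (g * h⁻¹) ∂μ = ∫ h, (fun h => f h⁻¹) h * sph lam (h⁻¹ * g⁻¹) ∂μ := by
    rw [← integral_inv μ (fun h => f h * sph lam (g * h⁻¹))]
    congr 1
    funext h
    simp only [inv_inv]
    rw [← sph_inv lam (g * h), mul_inv_rev]
  have e2 : ∫ h, f h * sph lam h ∂μ = ∫ h, (fun h => f h⁻¹) h * sph lam h ∂μ := by
    rw [← integral_inv μ (fun h => f h * sph lam h)]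
    congr 1
    funext h
    rw [sph_inv]
  rw [e1, e2, h1, sph_inv]

end measure

end Summit.Ventures.HodgeRepro2.T5SU11SphericalTransform
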